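import Summits.PneNP.PneNP.Theorems.KarlinRubinMonotoneBlindSwitchRun

/-!
# Route KarlinRubin, crux `MonotoneBlind` (stmt-PneNP-18027): constant depth — alternating monotone formulas

Stage C of the AC⁰ line (seat write-up `MonotoneBlind_AC0_announce.md`): syntax and semantics of alternating monotone
formulas of constant depth with unbounded fan-in on the slots of `Kₙ`, the explicit switched normal form of a depth-2
sub-formula under a clique restriction, and the one-level depth reduction.

* `swForm n d` — level `0`: a finite slot set; level `d+1`: a list of level-`d` formulas (depth `d+1` formulas);
* `swEval d pol f w` — alternating semantics with top polarity `pol` (`true` = OR, `false` = AND; a level-`0` set is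
  an OR-clause resp. an AND-term); so a CNF is a level-`1` formula read with `pol = false`, a DNF with `pol = true`;
* `swIn V d f` (all slots inside `V`), `swBnd M L d f` (fan-ins `≤ M`, level-`0` sets of `≤ L` slots),
  `swLeaves d pol f` (the depth-2 sub-formulas with their polarities, `length ≤ M^d`);
* `swDnf V₁ x l` — the EXPLICIT DNF extracted from the canonical runs of the CNF `l` under the restriction `(V₁, x)`
  (`swDnf_iff`: it represents the restricted CNF on every input agreeing with `x` off the inside of `V₁`, unconditionally;
  its terms are inside `V₁`); dually the DNF `l` is represented by the CNF `swDnf V₁ (¬x) l` (`swCnf_iff`);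
* `swReduce V₁ x d pol f` — replace every depth-2 sub-formula by its switched normal form and merge it into the gate
  above: a level-`(d+2)` formula becomes a level-`(d+1)` formula with the same top polarity, the same value on inputs
  agreeing with `x` off the inside of `V₁` (`swEval_swReduce`), and all slots inside `V₁` (`swIn_swReduce`).

All `--supports stmt-PneNP-18027`. Definitions: the five objects above (structural recursions on the level).
-/

set_option linter.dupNamespace false -- `Summit.PneNP.PneNP.…`: summit = sub-problem (D-0017)

namespace Summit.PneNP.PneNP.Theorems

open Finset
open Literature.Computability.Complexity
open Literature.Probability.RandomGraphs.PlantedClique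

variable {n : ℕ}

/-! ### Syntax and semantics -/

/-- **Alternating monotone formulas** on the slots of `Kₙ`, by level: a level-`0` formula is a finite set of slots, a
level-`(d+1)` formula is a list of level-`d` formulas (its children). [cite: Beame1994, §3] -/
def swForm (n : ℕ) : ℕ → Type
  | 0 => Finset (⊤ : SimpleGraph (Fin n)).edgeSet
  | d + 1 => List (swForm n d)

/-- A level-`0` formula as the slot set it is. [folklore] -/
abbrev swForm.sets (S : swForm n 0) : Finset (⊤ : SimpleGraph (Fin n)).edgeSet := S

/-- A level-`(d+1)` formula as the list of its children. [folklore] -/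
abbrev swForm.kids {d : ℕ} (f : swForm n (d + 1)) : List (swForm n d) := f

/-- The level-`0` formula of a slot set. [folklore] -/
abbrev swForm.leaf (S : Finset (⊤ : SimpleGraph (Fin n)).edgeSet) : swForm n 0 := S

/-- The level-`(d+1)` formula with the given children. [folklore] -/
abbrev swForm.node {d : ℕ} (l : List (swForm n d)) : swForm n (d + 1) := l

/-- **Semantics** with top polarity `pol` (`true` = OR gate / OR-clause, `false` = AND gate / AND-term); children have
the opposite polarity. [cite: Beame1994, §3] -/
def swEval : (d : ℕ) → Bool → swForm n d → EdgeVec n → Prop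
  | 0, true, S, w => ∃ e ∈ S.sets, w e = true
  | 0, false, S, w => ∀ e ∈ S.sets, w e = true
  | d + 1, true, l, w => ∃ g ∈ l.kids, swEval d false g w
  | d + 1, false, l, w => ∀ g ∈ l.kids, swEval d true g w

/-- All slots of the formula lie inside the vertex set `V`. [folklore] -/
def swIn (V : Finset (Fin n)) : (d : ℕ) → swForm n d → Prop
  | 0, S => ∀ e ∈ S.sets, ∀ v ∈ (e : Sym2 (Fin n)), v ∈ V
  | d + 1, l => ∀ g ∈ l.kids, swIn V d g

/-- Fan-ins `≤ M` and level-`0` sets of `≤ L` slots. [folklore] -/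
def swBnd (M L : ℕ) : (d : ℕ) → swForm n d → Prop
  | 0, S => S.sets.card ≤ L
  | d + 1, l => l.kids.length ≤ M ∧ ∀ g ∈ l.kids, swBnd M L d g

/-- The depth-2 sub-formulas (level-`1` nodes) of a level-`(d+1)` formula, with their polarities. [folklore] -/
def swLeaves : (d : ℕ) → Bool → swForm n (d + 1) → List (Bool × List (Finset (⊤ : SimpleGraph (Fin n)).edgeSet))
  | 0, pol, l => [(pol, l.kids)]
  | d + 1, pol, l => l.kids.flatMap fun g => swLeaves d (!pol) g

/-! ### Unfolding lemmas -/

/-- Unfolding `swEval` at level `0`, polarity OR. [folklore] -/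
theorem swEval_zero_true (S : swForm n 0) (w : EdgeVec n) : swEval 0 true S w ↔ ∃ e ∈ S.sets, w e = true := Iff.rfl

/-- Unfolding `swEval` at level `0`, polarity AND. [folklore] -/
theorem swEval_zero_false (S : swForm n 0) (w : EdgeVec n) : swEval 0 false S w ↔ ∀ e ∈ S.sets, w e = true := Iff.rfl

/-- Unfolding `swEval` at level `d+1`, polarity OR. [folklore] -/
theorem swEval_succ_true {d : ℕ} (l : swForm n (d + 1)) (w : EdgeVec n) :
    swEval (d + 1) true l w ↔ ∃ g ∈ l.kids, swEval d false g w := Iff.rfl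

/-- Unfolding `swEval` at level `d+1`, polarity AND. [folklore] -/
theorem swEval_succ_false {d : ℕ} (l : swForm n (d + 1)) (w : EdgeVec n) :
    swEval (d + 1) false l w ↔ ∀ g ∈ l.kids, swEval d true g w := Iff.rfl

/-- Unfolding `swIn` at level `0`. [folklore] -/
theorem swIn_zero (V : Finset (Fin n)) (S : swForm n 0) :
    swIn V 0 S ↔ ∀ e ∈ S.sets, ∀ v ∈ (e : Sym2 (Fin n)), v ∈ V := Iff.rfl

/-- Unfolding `swIn` at level `d+1`. [folklore] -/
theorem swIn_succ (V : Finset (Fin n)) {d : ℕ} (l : swForm n (d + 1)) :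
    swIn V (d + 1) l ↔ ∀ g ∈ l.kids, swIn V d g := Iff.rfl

/-- Unfolding `swBnd` at level `0`. [folklore] -/
theorem swBnd_zero (M L : ℕ) (S : swForm n 0) : swBnd M L 0 S ↔ S.sets.card ≤ L := Iff.rfl

/-- Unfolding `swBnd` at level `d+1`. [folklore] -/
theorem swBnd_succ (M L : ℕ) {d : ℕ} (l : swForm n (d + 1)) :
    swBnd M L (d + 1) l ↔ l.kids.length ≤ M ∧ ∀ g ∈ l.kids, swBnd M L d g := Iff.rfl

/-- Unfolding `swLeaves` at level `0`. [folklore] -/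
theorem swLeaves_zero (pol : Bool) (l : swForm n 1) : swLeaves 0 pol l = [(pol, l.kids)] := rfl

/-- Unfolding `swLeaves` at level `d+1`. [folklore] -/
theorem swLeaves_succ {d : ℕ} (pol : Bool) (l : swForm n (d + 2)) :
    swLeaves (d + 1) pol l = l.kids.flatMap fun g => swLeaves d (!pol) g := rfl

/-! ### The explicit switched normal form of a depth-2 sub-formula -/

open Classical in
/-- **Switched DNF** of the CNF with clause list `l` under the restriction `(V₁, x)`: the AND of the black queried slots
of every accepted inside assignment of the canonical run. [cite: Beame1994, §3] -/
noncomputable def swDnf (V₁ : Finset (Fin n)) (x : EdgeVec n) (l : List (Finset (⊤ : SimpleGraph (Fin n)).edgeSet)) :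
    Finset (Finset (⊤ : SimpleGraph (Fin n)).edgeSet) :=
  (univ.filter fun z : EdgeVec n => (swRun V₁ x z l ∅).1 = true).image
    fun z => (swRun V₁ x z l ∅).2.filter fun e => z e = true

/-- **The switched DNF represents the restricted CNF** on every input agreeing with `x` off the inside of `V₁`
(unconditionally). [cite: Beame1994, §3] -/
theorem swDnf_iff (V₁ : Finset (Fin n)) (x : EdgeVec n) (l : List (Finset (⊤ : SimpleGraph (Fin n)).edgeSet))
    (w : EdgeVec n) (hw : ∀ e : (⊤ : SimpleGraph (Fin n)).edgeSet, (¬ ∀ v ∈ (e : Sym2 (Fin n)), v ∈ V₁) → w e = x e) :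
    (∀ S ∈ l, ∃ e ∈ S, w e = true) ↔ ∃ T ∈ swDnf V₁ x l, ∀ e ∈ T, w e = true := by
  classical
  have hval : (∀ S ∈ l, ∃ e ∈ S, w e = true) ↔ (swRun V₁ x w l ∅).1 = true := by
    rw [swRun_fst_eq_true_iff]
    refine forall₂_congr fun S _ => exists_congr fun e => and_congr_right fun _ => ?_
    by_cases he : ∀ v ∈ (e : Sym2 (Fin n)), v ∈ V₁
    · exact ⟨fun h => Or.inl ⟨he, h⟩, fun h => h.elim (fun h => h.2) fun h => absurd he h.1⟩
    · rw [hw e he]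
      exact ⟨fun h => Or.inr ⟨he, h⟩, fun h => h.elim (fun h => absurd h.1 he) fun h => h.2⟩
  rw [hval, swRun_dnf]
  simp only [swDnf, mem_image, mem_filter, mem_univ, true_and]
  constructor
  · rintro ⟨z, hz, hdom⟩
    exact ⟨_, ⟨z, hz, rfl⟩, fun e he => hdom e (mem_filter.1 he).1 (mem_filter.1 he).2⟩
  · rintro ⟨T, ⟨z, hz, rfl⟩, hT⟩
    exact ⟨z, hz, fun e he hze => hT e (mem_filter.2 ⟨he, hze⟩)⟩

/-- **Dual form**: the DNF with term list `l` is represented, on inputs agreeing with `x` off the inside of `V₁`, by the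
CNF whose clauses are `swDnf V₁ (¬x) l`. [cite: Beame1994, §3] -/
theorem swCnf_iff (V₁ : Finset (Fin n)) (x : EdgeVec n) (l : List (Finset (⊤ : SimpleGraph (Fin n)).edgeSet))
    (w : EdgeVec n) (hw : ∀ e : (⊤ : SimpleGraph (Fin n)).edgeSet, (¬ ∀ v ∈ (e : Sym2 (Fin n)), v ∈ V₁) → w e = x e) :
    (∃ T ∈ l, ∀ e ∈ T, w e = true) ↔ ∀ S ∈ swDnf V₁ (fun e => !x e) l, ∃ e ∈ S, w e = true := by
  have h := swDnf_iff V₁ (fun e => !x e) l (fun e => !w e) fun e he => by simp [hw e he]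
  simp only [Bool.not_eq_true'] at h
  constructor
  · rintro ⟨T, hTl, hTw⟩ S hS
    by_contra hno
    have hno' : ∀ e ∈ S, w e = false := by
      intro e he
      cases hwe : w e
      · rfl
      · exact absurd ⟨e, he, hwe⟩ hno
    obtain ⟨e, heT, hwe⟩ := (h.2 ⟨S, hS, hno'⟩) T hTl
    rw [hTw e heT] at hwe
    cases hwe
  · intro hall
    by_contra hno
    have hcnf : ∀ S ∈ l, ∃ e ∈ S, w e = false := by
      intro S hS
      by_contra hS'
      refine hno ⟨S, hS, fun e he => ?_⟩
      cases hwe : w e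
      · exact absurd ⟨e, he, hwe⟩ hS'
      · rfl
    obtain ⟨T, hT, hTw⟩ := h.1 hcnf
    obtain ⟨e, heT, hwe⟩ := hall T hT
    rw [hTw e heT] at hwe
    cases hwe

/-- The terms of the switched DNF lie inside `V₁`. [folklore] -/
theorem swDnf_inside (V₁ : Finset (Fin n)) (x : EdgeVec n) (l : List (Finset (⊤ : SimpleGraph (Fin n)).edgeSet)) :
    ∀ T ∈ swDnf V₁ x l, ∀ e ∈ T, ∀ v ∈ (e : Sym2 (Fin n)), v ∈ V₁ := by
  classical
  intro T hT e he
  simp only [swDnf, mem_image, mem_filter, mem_univ, true_and] at hT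
  obtain ⟨z, -, rfl⟩ := hT
  exact inside_of_mem_swRun_snd V₁ x z l (mem_filter.1 he).1

/-- **On the good event the switched DNF is narrow and small**: if every canonical run meets `< v₀` vertices, every
term has `≤ C(v₀-1,2)` slots and there are `≤ (#slots+1)^{C(v₀-1,2)}` terms. [cite: Beame1994, §3] -/
theorem swDnf_bnd_of_good (V₁ : Finset (Fin n)) (x : EdgeVec n) (l : List (Finset (⊤ : SimpleGraph (Fin n)).edgeSet))
    (v₀ : ℕ) (hgood : ∀ z : EdgeVec n, #(univ.filter fun v : Fin n =>
      ∃ e ∈ (swRun V₁ x z l ∅).2, v ∈ (e : Sym2 (Fin n))) < v₀) :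
    (∀ T ∈ swDnf V₁ x l, #T ≤ (v₀ - 1).choose 2) ∧
      #(swDnf V₁ x l) ≤ (Fintype.card (⊤ : SimpleGraph (Fin n)).edgeSet + 1) ^ (v₀ - 1).choose 2 := by
  classical
  have hr : ∀ z : EdgeVec n, #(swRun V₁ x z l ∅).2 ≤ (v₀ - 1).choose 2 := by
    intro z
    refine (card_le_choose_two_of_inside' (univ.filter fun v : Fin n =>
      ∃ e ∈ (swRun V₁ x z l ∅).2, v ∈ (e : Sym2 (Fin n))) _ fun e he v hv =>
        mem_filter.2 ⟨mem_univ _, e, he, hv⟩).trans (Nat.choose_le_choose 2 ?_)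
    have := hgood z
    omega
  refine ⟨fun T hT => ?_, ?_⟩
  · simp only [swDnf, mem_image, mem_filter, mem_univ, true_and] at hT
    obtain ⟨z, -, rfl⟩ := hT
    exact (card_filter_le _ _).trans (hr z)
  · refine le_trans (card_le_card fun T hT => ?_) (switch_card_filter_powerset_card_le ((v₀ - 1).choose 2))
    simp only [swDnf, mem_image, mem_filter, mem_univ, true_and] at hT
    obtain ⟨z, -, rfl⟩ := hT
    rw [mem_filter, mem_powerset]
    exact ⟨subset_univ _, (card_filter_le _ _).trans (hr z)⟩
where
  /-- local copy of `card_le_choose_two_of_inside` (slot sets inside `W` have `≤ C(#W,2)` slots). [folklore] -/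
  card_le_choose_two_of_inside' (W : Finset (Fin n)) (T : Finset (⊤ : SimpleGraph (Fin n)).edgeSet)
      (hT : ∀ e ∈ T, ∀ v ∈ (e : Sym2 (Fin n)), v ∈ W) : #T ≤ (#W).choose 2 := by
    classical
    have h := card_filter_inside_le_choose W T
    rw [filter_true_of_mem hT] at h
    exact h.trans (Nat.choose_le_choose 2 (card_le_card inter_subset_left))

/-! ### One level of depth reduction -/

/-- **Depth reduction by one level**: replace every depth-2 sub-formula of a level-`(d+2)` formula by its switched
normal form (CNF children of an OR gate by their switched DNFs, DNF children of an AND gate by their switched CNFs) and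
merge it into the gate above. [cite: Beame1994, §3] -/
noncomputable def swReduce (V₁ : Finset (Fin n)) (x : EdgeVec n) : (d : ℕ) → Bool → swForm n (d + 2) → swForm n (d + 1)
  | 0, true, l => swForm.node (l.kids.flatMap fun c => ((swDnf V₁ x c.kids).toList.map swForm.leaf))
  | 0, false, l => swForm.node (l.kids.flatMap fun c => ((swDnf V₁ (fun e => !x e) c.kids).toList.map swForm.leaf))
  | d + 1, pol, l => swForm.node (l.kids.map fun g => swReduce V₁ x d (!pol) g)

/-- Unfolding `swReduce` at level `0`, polarity OR (OR of CNFs ↦ DNF). [folklore] -/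
theorem swReduce_zero_true (V₁ : Finset (Fin n)) (x : EdgeVec n) (l : swForm n 2) :
    swReduce V₁ x 0 true l = swForm.node (l.kids.flatMap fun c => ((swDnf V₁ x c.kids).toList.map swForm.leaf)) := rfl

/-- Unfolding `swReduce` at level `0`, polarity AND (AND of DNFs ↦ CNF). [folklore] -/
theorem swReduce_zero_false (V₁ : Finset (Fin n)) (x : EdgeVec n) (l : swForm n 2) :
    swReduce V₁ x 0 false l =
      swForm.node (l.kids.flatMap fun c => ((swDnf V₁ (fun e => !x e) c.kids).toList.map swForm.leaf)) := rfl

/-- Unfolding `swReduce` at level `d+1`. [folklore] -/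
theorem swReduce_succ (V₁ : Finset (Fin n)) (x : EdgeVec n) {d : ℕ} (pol : Bool) (l : swForm n (d + 3)) :
    swReduce V₁ x (d + 1) pol l = swForm.node (l.kids.map fun g => swReduce V₁ x d (!pol) g) := rfl

/-- **The reduced formula has the same value** on every input agreeing with `x` off the inside of `V₁`.
[cite: Beame1994, §3] -/
theorem swEval_swReduce (V₁ : Finset (Fin n)) (x : EdgeVec n) (w : EdgeVec n)
    (hw : ∀ e : (⊤ : SimpleGraph (Fin n)).edgeSet, (¬ ∀ v ∈ (e : Sym2 (Fin n)), v ∈ V₁) → w e = x e) :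
    ∀ (d : ℕ) (pol : Bool) (f : swForm n (d + 2)), swEval (d + 2) pol f w ↔ swEval (d + 1) pol (swReduce V₁ x d pol f) w := by
  intro d
  induction d with
  | zero =>
    intro pol f
    cases pol
    · -- AND over DNF children
      rw [swReduce_zero_false, swEval_succ_false, swEval_succ_false]
      simp only [swForm.kids, swForm.node, List.mem_flatMap, List.mem_map, Finset.mem_toList, swEval_succ_true,
        swEval_zero_false, swEval_zero_true, swForm.sets, swForm.leaf]
      constructor
      · rintro h S ⟨c, hc, T, hT, rfl⟩
        exact (swCnf_iff V₁ x c w hw).1 (h c hc) T hT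
      · intro h c hc
        exact (swCnf_iff V₁ x c w hw).2 fun S hS => h S ⟨c, hc, S, hS, rfl⟩
    · -- OR over CNF children
      rw [swReduce_zero_true, swEval_succ_true, swEval_succ_true]
      simp only [swForm.kids, swForm.node, List.mem_flatMap, List.mem_map, Finset.mem_toList, swEval_succ_false,
        swEval_zero_false, swEval_zero_true, swForm.sets, swForm.leaf]
      constructor
      · rintro ⟨c, hc, h⟩
        obtain ⟨T, hT, hTw⟩ := (swDnf_iff V₁ x c w hw).1 h
        exact ⟨T, ⟨c, hc, T, hT, rfl⟩, hTw⟩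
      · rintro ⟨T, ⟨c, hc, T', hT', rfl⟩, hTw⟩
        exact ⟨c, hc, (swDnf_iff V₁ x c w hw).2 ⟨T', hT', hTw⟩⟩
  | succ d ih =>
    intro pol f
    cases pol
    · rw [swReduce_succ, swEval_succ_false, swEval_succ_false]
      simp only [swForm.kids, swForm.node, List.mem_map]
      constructor
      · rintro h g ⟨g', hg', rfl⟩
        exact (ih true g').1 (h g' hg')
      · intro h g hg
        exact (ih true g).2 (h _ ⟨g, hg, rfl⟩)
    · rw [swReduce_succ, swEval_succ_true, swEval_succ_true]
      simp only [swForm.kids, swForm.node, List.mem_map]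
      constructor
      · rintro ⟨g, hg, h⟩
        exact ⟨_, ⟨g, hg, rfl⟩, (ih false g).1 h⟩
      · rintro ⟨g, ⟨g', hg', rfl⟩, h⟩
        exact ⟨g', hg', (ih false g').2 h⟩

/-- **The reduced formula lives inside `V₁`.** [folklore] -/
theorem swIn_swReduce (V₁ : Finset (Fin n)) (x : EdgeVec n) :
    ∀ (d : ℕ) (pol : Bool) (f : swForm n (d + 2)), swIn V₁ (d + 1) (swReduce V₁ x d pol f) := by
  intro d
  induction d with
  | zero =>
    intro pol f
    cases pol
    · rw [swReduce_zero_false, swIn_succ]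
      simp only [swForm.kids, swForm.node, List.mem_flatMap, List.mem_map, Finset.mem_toList, swIn_zero,
        swForm.sets, swForm.leaf]
      rintro S ⟨c, -, T, hT, rfl⟩
      exact swDnf_inside V₁ _ _ T hT
    · rw [swReduce_zero_true, swIn_succ]
      simp only [swForm.kids, swForm.node, List.mem_flatMap, List.mem_map, Finset.mem_toList, swIn_zero,
        swForm.sets, swForm.leaf]
      rintro S ⟨c, -, T, hT, rfl⟩
      exact swDnf_inside V₁ x _ T hT
  | succ d ih =>
    intro pol f
    rw [swReduce_succ, swIn_succ]
    simp only [swForm.kids, swForm.node, List.mem_map]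
    rintro g ⟨g', -, rfl⟩
    exact ih (!pol) g'

/-- De Morgan for a monotone DNF against its term family read as a CNF on the complemented input. [folklore] -/
theorem exists_forall_true_iff_not_forall_exists_false {α : Type*} (l : List (Finset α)) (w : α → Bool) :
    (∃ T ∈ l, ∀ e ∈ T, w e = true) ↔ ¬ ∀ T ∈ l, ∃ e ∈ T, w e = false := by
  constructor
  · rintro ⟨T, hT, hTw⟩ h
    obtain ⟨e, he, hwe⟩ := h T hT
    rw [hTw e he] at hwe
    cases hwe
  · intro h
    by_contra hno
    refine h fun T hT => ?_
    by_contra hT'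
    refine hno ⟨T, hT, fun e he => ?_⟩
    cases hwe : w e
    · exact absurd ⟨e, he, hwe⟩ hT'
    · rfl

/-- Registered stub `stub_formDefs` of the AC⁰ line, stage C (the de Morgan step behind `swCnf_iff`). [folklore] -/
theorem stub_formDefs :
    ∀ (l : List (Finset ℕ)) (w : ℕ → Bool), (∃ T ∈ l, ∀ e ∈ T, w e = true) ↔ ¬ ∀ T ∈ l, ∃ e ∈ T, w e = false :=
  fun l w => exists_forall_true_iff_not_forall_exists_false l w

end Summit.PneNP.PneNP.Theorems
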